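import Summits.CriticalPhenomena.PercolationContinuityZ3.Theorems.FK.BoxLimitSemicontinuity
import Summits.CriticalPhenomena.PercolationContinuityZ3.Theorems.FK.FreeWiredCoincidence
import Summits.CriticalPhenomena.PercolationContinuityZ3.Theorems.FK.InfiniteVolumeStochasticOrder
import HarnessLib

/-!
# FK-continuity cell, FO-10a: the free and wired probabilities of an increasing local event INTERLACE in `p` —
# `φ¹_{p,q}(A) ≤ φ⁰_{p',q}(A)` for `p < p'`, `φ⁰_{·,q}(A)(p+) = φ¹_{p,q}(A)`, `φ¹_{·,q}(A)(p−) = φ⁰_{p,q}(A)` — and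
# `φ⁰_{p,q} = φ¹_{p,q}` iff `t ↦ φ⁰_{t,q}(A)` is continuous at `p` for every increasing local event `A`
# (Grimmett 2006, Thm. (4.63)(b) / eqs (4.73)–(4.78) for ALL increasing local events, Prop. (4.28)(b)(c))

Registered R82 (cell INBOX l.5940, 2026-08-24); registry row FO-10a-g337p; label PCT-A (coordinator fk-4 g175).
Cell `fk-continuity` (bschramm), row FO-10a (domain-Markov + comparison layer over FO-06); support file for the
FK-continuity transplant (`--supports stmt-CriticalPhenomena-4575`); builds on p205010 (kernel theorem, internal audit
signed; external expert review pending). Pure proofs; no definitions, no named facts, no sorries; general `d`.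

Row FO-10a-g335s (`BoxLimitSemicontinuity.lean`) proved the ONE-SIDED continuity of `t ↦ φ^b_{t,q}(A)` for an increasing
local event `A` (Prop. (4.28)(b)(c): `φ¹` right-, `φ⁰` left-continuous); rows FO-10a-g336h / -g336t read the CROSS limits
`h⁰(p+) = h¹(p)`, `θ⁰(p+) = θ¹(p)` for the edge event and for `{0 ↔ ∞}`. Here the cross limits and the continuity criterion
for EVERY increasing local event, by the interlacing trick of `ThetaInterlacing.lean`: between `p < p'` there is a parameter
`x` with `φ⁰_{x,q} = φ¹_{x,q}` (the exceptional set is countable, FO-07b `countable_setOf_rcLimit_false_ne_rcLimit_true`), so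
`φ¹_p(A) ≤ φ¹_x(A) = φ⁰_x(A) ≤ φ⁰_{p'}(A)` by monotonicity in `p` (Prop. (4.28)(a), `rcLimit_real_mono_left`).

* `exists_mem_Ioo_rcLimit_false_eq_rcLimit_true` — between any `0 ≤ a < b ≤ 1` some `x` has `φ⁰_{x,q} = φ¹_{x,q}`;
* **`rcLimit_true_real_le_rcLimit_false_real_of_lt`** — `φ¹_{p,q}(A) ≤ φ⁰_{p',q}(A)` for `p < p'`, `A` increasing local
  (Grimmett's (4.73)–(4.76) for every increasing local event, not only the edge event);
* **`tendsto_rcLimit_false_real_nhdsGT_of_determinedBy`** — `φ⁰_{t,q}(A) → φ¹_{p,q}(A)` as `t ↓ p` (`d ≥ 1`, `0 ≤ p < 1`);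
  **`tendsto_rcLimit_true_real_nhdsLT_of_determinedBy`** — `φ¹_{t,q}(A) → φ⁰_{p,q}(A)` as `t ↑ p` (`0 < p ≤ 1`);
* `continuousAt_rcLimit_false_real_iff_of_determinedBy` / `continuousAt_rcLimit_true_real_iff_of_determinedBy` —
  `t ↦ φ⁰_{t,q}(A)` (resp. `φ¹`) is continuous at `p ∈ (0,1)` iff `φ⁰_{p,q}(A) = φ¹_{p,q}(A)`;
* HEADLINE **`rcLimit_false_eq_rcLimit_true_iff_forall_continuousAt (hd : 0 < d) (hp : p ∈ Ioo 0 1) (hq : 1 ≤ q) :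
  φ⁰_{p,q} = φ¹_{p,q} ↔ ∀ A F, IsUpperSet A → DeterminedBy A ↑F → ContinuousAt (fun t => (rcLimit d false t q).real A) p`**
  — uniqueness at `p` iff every increasing local probability is continuous in the parameter at `p` (⇐ through the
  edge event and Thm. (4.63); ⇒ since then `φ⁰_p(A) = φ¹_p(A) = φ⁰(p+)`); `not_continuousAt_rcLimit_real_of_ne` — at a point of
  phase coexistence SOME increasing local probability (indeed the edge density) jumps.

Honest framing: UNCONDITIONAL structure; it decides nothing about `q ∈ (1,2)` at `p_c(q)`; NOT a binder discharge, NOT `_r4`;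
`_r3` « 2 / 0 ☑ », n_open = 2 unchanged.

## References

* G. Grimmett, *The Random-Cluster Model*, Springer 2006 (`book:grimmett2006-random-cluster-model`): Prop. (4.28) [PDF p. 80],
  Thm. (4.63) and its proof, eqs (4.73)–(4.78) [PDF pp. 89, 92–93], Thm. (5.16) [PDF p. 101]. [Grimmett2006]
-/

noncomputable section

open MeasureTheory Set Filter
open scoped Topology ENNReal

namespace Summit.CriticalPhenomena.PercolationContinuityZ3.Theorems.FK

open Literature.Probability.Percolation Literature.Probability.LatticeModels

variable {d : ℕ} {p p' q : ℝ} {A : Set (BondConfig (Site d))} {F : Finset (Sym2 (Site d))}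

/-! ### Interlacing -/

/-- Between any two parameters `0 ≤ a < b ≤ 1` there is one at which `φ⁰_{x,q} = φ¹_{x,q}` (`q ≥ 1`): the exceptional
set is countable (Thm. (4.63)) and a countable set of reals has dense complement. [cite: Grimmett2006, Thm. (4.63) with Thm. (4.60)] -/
theorem exists_mem_Ioo_rcLimit_false_eq_rcLimit_true (hq : 1 ≤ q) {a b : ℝ} (ha : 0 ≤ a) (hb : b ≤ 1)
    (hab : a < b) : ∃ x ∈ Set.Ioo a b, rcLimit d false x q = rcLimit d true x q := by
  have hdense := Set.Countable.dense_compl ℝ (countable_setOf_rcLimit_false_ne_rcLimit_true (d := d) hq)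
  have hne : (Set.Ioo a b).Nonempty := ⟨(a + b) / 2, by constructor <;> linarith⟩
  obtain ⟨x, hxS, hxI⟩ := hdense.exists_mem_open (isOpen_Ioo (a := a) (b := b)) hne
  refine ⟨x, hxI, ?_⟩
  by_contra hne'
  exact hxS ⟨⟨ha.trans hxI.1.le, hxI.2.le.trans hb⟩, hne'⟩

/-- **Interlacing: `φ¹_{p,q}(A) ≤ φ⁰_{p',q}(A)` whenever `0 ≤ p < p' ≤ 1`**, for every increasing local event `A` (`q ≥ 1`):
through a parameter `p < x < p'` with `φ⁰_{x,q} = φ¹_{x,q}`, `φ¹_p(A) ≤ φ¹_x(A) = φ⁰_x(A) ≤ φ⁰_{p'}(A)`.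
[cite: Grimmett2006, Thm. (4.63) (proof, (4.73)–(4.76)) with Prop. (4.28)(a)] -/
theorem rcLimit_true_real_le_rcLimit_false_real_of_lt (hq : 1 ≤ q) (hp : p ∈ Set.Icc (0 : ℝ) 1)
    (hp' : p' ∈ Set.Icc (0 : ℝ) 1) (hlt : p < p') (hAu : IsUpperSet A) (hA : DeterminedBy A ↑F) :
    (rcLimit d true p q).real A ≤ (rcLimit d false p' q).real A := by
  obtain ⟨x, hx, hEq⟩ := exists_mem_Ioo_rcLimit_false_eq_rcLimit_true (d := d) hq hp.1 hp'.2 hlt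
  have hxI : x ∈ Set.Icc (0 : ℝ) 1 := ⟨hp.1.trans hx.1.le, hx.2.le.trans hp'.2⟩
  calc (rcLimit d true p q).real A
      ≤ (rcLimit d true x q).real A :=
        rcLimit_real_mono_left true (exists_isBoxLimit true hp hq) (exists_isBoxLimit true hxI hq) hp hxI hx.1.le hq hAu hA
    _ = (rcLimit d false x q).real A := by rw [hEq]
    _ ≤ (rcLimit d false p' q).real A :=
        rcLimit_real_mono_left false (exists_isBoxLimit false hxI hq) (exists_isBoxLimit false hp' hq) hxI hp' hx.2.le hq
          hAu hA

/-! ### Cross limits: `φ⁰(A)(p+) = φ¹_p(A)`, `φ¹(A)(p−) = φ⁰_p(A)` -/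

/-- **`φ⁰_{t,q}(A) → φ¹_{p,q}(A)` as `t ↓ p`** (`d ≥ 1`, `0 ≤ p < 1`, `q ≥ 1`, `A` increasing local): squeeze between
`φ¹_p(A) ≤ φ⁰_t(A)` (interlacing) and `φ⁰_t(A) ≤ φ¹_t(A) → φ¹_p(A)` (right-continuity of `φ¹`, Prop. (4.28)(b)).
[cite: Grimmett2006, Thm. (4.63) (proof, (4.77)–(4.78)) with Prop. (4.28)(b)] -/
theorem tendsto_rcLimit_false_real_nhdsGT_of_determinedBy (hd : 0 < d) (hq : 1 ≤ q) (hA : DeterminedBy A ↑F)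
    (hAu : IsUpperSet A) (hp : p ∈ Set.Ico (0 : ℝ) 1) :
    Tendsto (fun t : ℝ => (rcLimit d false t q).real A) (𝓝[>] p) (𝓝 ((rcLimit d true p q).real A)) := by
  have hright := tendsto_rcLimit_true_real_nhdsGT hd hq hA hAu hp
  have hpI : p ∈ Set.Icc (0 : ℝ) 1 := ⟨hp.1, hp.2.le⟩
  refine tendsto_of_tendsto_of_tendsto_of_le_of_le' tendsto_const_nhds hright ?_ ?_
  · filter_upwards [Ioo_mem_nhdsGT hp.2] with t ht
    exact rcLimit_true_real_le_rcLimit_false_real_of_lt hq hpI ⟨hp.1.trans ht.1.le, ht.2.le⟩ ht.1 hAu hA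
  · filter_upwards [Ioo_mem_nhdsGT hp.2] with t ht
    have htI : t ∈ Set.Icc (0 : ℝ) 1 := ⟨hp.1.trans ht.1.le, ht.2.le⟩
    exact ((isBoxLimit_rcLimit true htI hq).fkGibbs htI hq).rcLimit_false_real_le_of_measurableSet htI hq hAu
      (measurableSet_of_isLocalEvent_holds ⟨F, hA⟩)

/-- **`φ¹_{t,q}(A) → φ⁰_{p,q}(A)` as `t ↑ p`** (`0 < p ≤ 1`, `q ≥ 1`, `A` increasing local): squeeze between
`φ⁰_t(A) ≤ φ¹_t(A)` and `φ¹_t(A) ≤ φ⁰_p(A)` (interlacing), with `φ⁰_t(A) → φ⁰_p(A)` (left-continuity of `φ⁰`, Prop. (4.28)(c)).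
[cite: Grimmett2006, Thm. (4.63) (proof, (4.77)–(4.78)) with Prop. (4.28)(c)] -/
theorem tendsto_rcLimit_true_real_nhdsLT_of_determinedBy (hq : 1 ≤ q) (hA : DeterminedBy A ↑F) (hAu : IsUpperSet A)
    (hp : p ∈ Set.Ioc (0 : ℝ) 1) :
    Tendsto (fun t : ℝ => (rcLimit d true t q).real A) (𝓝[<] p) (𝓝 ((rcLimit d false p q).real A)) := by
  have hleft := tendsto_rcLimit_false_real_nhdsLT hq hA hAu hp
  have hpI : p ∈ Set.Icc (0 : ℝ) 1 := ⟨hp.1.le, hp.2⟩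
  refine tendsto_of_tendsto_of_tendsto_of_le_of_le' hleft tendsto_const_nhds ?_ ?_
  · filter_upwards [Ioo_mem_nhdsLT hp.1] with t ht
    have htI : t ∈ Set.Icc (0 : ℝ) 1 := ⟨ht.1.le, ht.2.le.trans hp.2⟩
    exact ((isBoxLimit_rcLimit true htI hq).fkGibbs htI hq).rcLimit_false_real_le_of_measurableSet htI hq hAu
      (measurableSet_of_isLocalEvent_holds ⟨F, hA⟩)
  · filter_upwards [Ioo_mem_nhdsLT hp.1] with t ht
    exact rcLimit_true_real_le_rcLimit_false_real_of_lt hq ⟨ht.1.le, ht.2.le.trans hp.2⟩ hpI ht.2 hAu hA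

/-! ### Continuity at `p` of an increasing local probability iff no jump at `p` -/

/-- **`t ↦ φ⁰_{t,q}(A)` is continuous at `p ∈ (0,1)` iff `φ⁰_{p,q}(A) = φ¹_{p,q}(A)`** (`d ≥ 1`, `q ≥ 1`, `A` increasing local):
`φ⁰(A)` is left-continuous with right limit `φ¹_p(A)`. [cite: Grimmett2006, Thm. (4.63)(b) (proof, (4.77)–(4.78))] -/
theorem continuousAt_rcLimit_false_real_iff_of_determinedBy (hd : 0 < d) (hq : 1 ≤ q) (hA : DeterminedBy A ↑F)
    (hAu : IsUpperSet A) (hp : p ∈ Set.Ioo (0 : ℝ) 1) :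
    ContinuousAt (fun t : ℝ => (rcLimit d false t q).real A) p ↔
      (rcLimit d false p q).real A = (rcLimit d true p q).real A := by
  have hright := tendsto_rcLimit_false_real_nhdsGT_of_determinedBy hd hq hA hAu ⟨hp.1.le, hp.2⟩
  constructor
  · intro hc
    exact tendsto_nhds_unique (hc.tendsto.mono_left nhdsWithin_le_nhds) hright
  · intro heq
    rw [continuousAt_iff_continuous_left'_right']
    refine ⟨?_, ?_⟩
    · exact ((continuousWithinAt_Icc_iff_Iic hp.1).1
        (continuousWithinAt_Icc_rcLimit_false_real hq hA hAu ⟨hp.1.le, hp.2.le⟩)).mono Set.Iio_subset_Iic_self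
    · rw [ContinuousWithinAt, heq]
      exact hright

/-- **`t ↦ φ¹_{t,q}(A)` is continuous at `p ∈ (0,1)` iff `φ⁰_{p,q}(A) = φ¹_{p,q}(A)`** (`d ≥ 1`, `q ≥ 1`, `A` increasing local):
`φ¹(A)` is right-continuous with left limit `φ⁰_p(A)`. [cite: Grimmett2006, Thm. (4.63)(b) (proof, (4.77)–(4.78))] -/
theorem continuousAt_rcLimit_true_real_iff_of_determinedBy (hd : 0 < d) (hq : 1 ≤ q) (hA : DeterminedBy A ↑F)
    (hAu : IsUpperSet A) (hp : p ∈ Set.Ioo (0 : ℝ) 1) :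
    ContinuousAt (fun t : ℝ => (rcLimit d true t q).real A) p ↔
      (rcLimit d false p q).real A = (rcLimit d true p q).real A := by
  have hleft := tendsto_rcLimit_true_real_nhdsLT_of_determinedBy hq hA hAu ⟨hp.1, hp.2.le⟩
  constructor
  · intro hc
    exact (tendsto_nhds_unique (hc.tendsto.mono_left nhdsWithin_le_nhds) hleft).symm
  · intro heq
    rw [continuousAt_iff_continuous_left'_right']
    refine ⟨?_, ?_⟩
    · rw [ContinuousWithinAt, ← heq]
      exact hleft
    · exact ((continuousWithinAt_Icc_iff_Ici hp.2).1
        (continuousWithinAt_Icc_rcLimit_true_real hd hq hA hAu ⟨hp.1.le, hp.2.le⟩)).mono Set.Ioi_subset_Ici_self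

/-! ### Uniqueness at `p` iff every increasing local probability is continuous at `p` -/

/-- **`φ⁰_{p,q} = φ¹_{p,q}` iff `t ↦ φ⁰_{t,q}(A)` is continuous at `p` for EVERY increasing local event `A`** (`d ≥ 1`,
`0 < p < 1`, `q ≥ 1`). (⇒): `φ⁰_p(A) = φ¹_p(A)` is the right limit, and `φ⁰(A)` is left-continuous; (⇐): the edge event
`{e open}` is increasing and local, and one edge of equal density suffices (Thm. (4.63)).
[cite: Grimmett2006, Thm. (4.63) ((b) ⟺ (d)) with Prop. (4.28)] -/
theorem rcLimit_false_eq_rcLimit_true_iff_forall_continuousAt (hd : 0 < d) (hp : p ∈ Set.Ioo (0 : ℝ) 1) (hq : 1 ≤ q) :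
    rcLimit d false p q = rcLimit d true p q ↔
      ∀ (A : Set (BondConfig (Site d))) (F : Finset (Sym2 (Site d))), IsUpperSet A → DeterminedBy A ↑F →
        ContinuousAt (fun t : ℝ => (rcLimit d false t q).real A) p := by
  constructor
  · intro h A F hAu hA
    exact (continuousAt_rcLimit_false_real_iff_of_determinedBy hd hq hA hAu hp).2 (by rw [h])
  · intro h
    -- the edge event at the lattice edge `e₀ = ⟨0, e_1⟩`
    set x₀ : Site d := 0 with hx₀
    set y₀ : Site d := (0 : Site d) + Pi.single (⟨0, hd⟩ : Fin d) 1 with hy₀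
    have hxy : (zdGraph d).Adj x₀ y₀ := (zdGraph_adj_iff _ _).2 ⟨⟨0, hd⟩, Or.inl rfl⟩
    have he : s(x₀, y₀) ∈ (zdGraph d).edgeSet := (SimpleGraph.mem_edgeSet _).2 hxy
    obtain ⟨hAu, hA⟩ := isUpperSet_setOf_mem_and_determinedBy (d := d) s(x₀, y₀)
    have hc := (continuousAt_rcLimit_false_real_iff_of_determinedBy hd hq hA hAu hp).1 (h _ _ hAu hA)
    rw [rcLimit_false_eq_rcLimit_true_iff_of_mem_edgeSet ⟨hp.1.le, hp.2.le⟩ hq he,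
      ← (isBoxLimit_rcLimit false ⟨hp.1.le, hp.2.le⟩ hq).real_setOf_mem_eq_freeEdgeDensity ⟨hp.1.le, hp.2.le⟩ hq,
      ← (isBoxLimit_rcLimit true ⟨hp.1.le, hp.2.le⟩ hq).real_setOf_mem_eq_wiredEdgeDensity hd ⟨hp.1.le, hp.2.le⟩ hq]
    exact hc

/-- **At a point of phase coexistence some increasing local probability is DIScontinuous in `p`** — indeed the
edge density, in either boundary condition (`d ≥ 1`, `0 < p < 1`, `q ≥ 1`). [cite: Grimmett2006, Thm. (4.63)] -/
theorem not_continuousAt_rcLimit_real_setOf_mem_of_ne (hp : p ∈ Set.Ioo (0 : ℝ) 1) (hq : 1 ≤ q)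
    (hne : rcLimit d false p q ≠ rcLimit d true p q) {x y : Site d} (hxy : (zdGraph d).Adj x y) (b : Bool) :
    ¬ ContinuousAt (fun t : ℝ => (rcLimit d b t q).real {ω | s(x, y) ∈ ω}) p := by
  obtain ⟨i, -⟩ := (zdGraph_adj_iff x y).1 hxy
  have hd : 0 < d := i.pos
  have he : s(x, y) ∈ (zdGraph d).edgeSet := (SimpleGraph.mem_edgeSet _).2 hxy
  obtain ⟨hAu, hA⟩ := isUpperSet_setOf_mem_and_determinedBy (d := d) s(x, y)
  have key : ¬ (rcLimit d false p q).real {ω | s(x, y) ∈ ω} = (rcLimit d true p q).real {ω | s(x, y) ∈ ω} := by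
    intro heq
    refine hne ((rcLimit_false_eq_rcLimit_true_iff_of_mem_edgeSet ⟨hp.1.le, hp.2.le⟩ hq he).2 ?_)
    rwa [(isBoxLimit_rcLimit false ⟨hp.1.le, hp.2.le⟩ hq).real_setOf_mem_eq_freeEdgeDensity ⟨hp.1.le, hp.2.le⟩ hq,
      (isBoxLimit_rcLimit true ⟨hp.1.le, hp.2.le⟩ hq).real_setOf_mem_eq_wiredEdgeDensity hd ⟨hp.1.le, hp.2.le⟩ hq] at heq
  cases b
  · exact fun hc => key ((continuousAt_rcLimit_false_real_iff_of_determinedBy hd hq hA hAu hp).1 hc)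
  · exact fun hc => key ((continuousAt_rcLimit_true_real_iff_of_determinedBy hd hq hA hAu hp).1 hc)

end Summit.CriticalPhenomena.PercolationContinuityZ3.Theorems.FK

end
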